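import Summits.Ventures.PercRepro.Night2GoodTwoD2Shape

/-!
# night-2: the shape of a distance-2 target, with the axis of the loading set identified

`d2Target_shape` describes a distance-2 target `T` of a covered lossy big pair `(B, z)` as
`T ∖ K = R ∪ {wₐ, p₁} ∪ {w_b, p₂} ∪ {w_c}`, but its statement does not say which five of the points lie in
`Q = insert z B`.  `d2Target_shape'` (the same proof) adds `coloops (Q ∖ K) = {wₐ, w_b, w_c}` and
`R = (Q ∖ K) ∖ coloops (Q ∖ K)` — the AXIS of the loading set — which the counting of the loading pairs needs
(paper NIGHT-2-g30 §7.4).  Two small facts follow: a distance-2 target has a coloop off `K`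
(`w_c`, `coloops_nonempty_of_mem_d2Targets`), and the rank-intersection principle `mem_clF_of_mem_clF_of_mem_clF`
(a point of two flats `clF X`, `clF Y` lies in `clF Z` for a common subset `Z` with `rk X + rk Y ≤ rk (X ∪ Y) + rk Z`).
-/

namespace PercRepro.Shadow

open PercRepro.ThmH PercRepro.PerFlat

variable {α : Type*} [DecidableEq α] {M : Matroid α} [M.Finite] {G : Finset α}

/-- **Rank intersection**: a point of two flats `clF X`, `clF Y` lies in `clF Z` for a common subset `Z` of `X`, `Y`
with `rk X + rk Y ≤ rk (X ∪ Y) + rk Z` (submodularity bounds the rank of `clF X ∩ clF Y` by `rk Z`). -/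
theorem mem_clF_of_mem_clF_of_mem_clF {X Y Z : Finset α} (hXg : X ⊆ gr M) (hYg : Y ⊆ gr M)
    (hZX : Z ⊆ X) (hZY : Z ⊆ Y) (hr : rkN M X + rkN M Y ≤ rkN M (X ∪ Y) + rkN M Z)
    {x : α} (hxX : x ∈ clF M X) (hxY : x ∈ clF M Y) : x ∈ clF M Z := by
  have hZg : Z ⊆ gr M := hZX.trans hXg
  have hxg : x ∈ gr M := mem_gr_of_mem_clF hxX
  have hI := rkN_inter_clF_add_le (M := M) hXg hYg
  have hsub : insert x Z ⊆ clF M X ∩ clF M Y := by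
    intro a ha
    rw [Finset.mem_insert] at ha
    rw [Finset.mem_inter]
    rcases ha with rfl | ha
    · exact ⟨hxX, hxY⟩
    · exact ⟨subset_clF_of_subset_gr hXg (hZX ha), subset_clF_of_subset_gr hYg (hZY ha)⟩
  have h1 : rkN M (insert x Z) ≤ rkN M Z := by
    have := rkN_mono (M := M) hsub
    omega
  have h2 : rkN M Z ≤ rkN M (insert x Z) := rkN_mono (Finset.subset_insert _ _)
  exact mem_clF_of_rkN_eq (Finset.subset_insert _ _) (Finset.insert_subset hxg hZg) (by omega)
    (Finset.mem_insert_self _ _)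

/-- **The shape of a distance-2 target, with the loading set's coloops named**: `d2Target_shape` (whose proof this
repeats) together with `coloops (Q ∖ K) = {wₐ, w_b, w_c}`, `R = (Q ∖ K) ∖ coloops (Q ∖ K)` (the AXIS of `Q`) and
`Q ∖ K = R ∪ {wₐ, w_b, w_c}`. -/
theorem d2Target_shape' (hG : G ∈ flatsQ M (5 + 1)) (hd : (gr M \ G).card = 2)
    (hk : kColoops M G = 1) (hs : ∀ e ∈ gr M, ∀ f ∈ gr M, e ≠ f → rkN M {e, f} = 2)
    (hl : ∀ e ∈ gr M, M.Indep {e}) {B : Finset α} (hB : B ∈ thinMembers M 5 G)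
    (hbig : 5 ≤ (B \ coloops M G).card) {z : α} (hz : z ∈ G \ clF M B) (h : loss M 5 G B z ≠ 0)
    (hno : ¬ (gtPts M 5 G (insert z B)).Nonempty) {T : Finset α} (hT : T ∈ d2Targets M 5 G (insert z B)) :
    ∃ (R : Finset α) (wa wb wc p1 p2 : α),
      coloops M (insert z B \ coloops M G) = {wa, wb, wc} ∧
      R = (insert z B \ coloops M G) \ coloops M (insert z B \ coloops M G) ∧
      insert z B \ coloops M G = R ∪ {wa, wb, wc} ∧
      T \ coloops M G = insert p1 (insert p2 (R ∪ {wa, wb, wc})) ∧ T ⊆ G ∧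
      rkN M R = 2 ∧ 3 ≤ R.card ∧ R ⊆ G ∧
      wa ∉ R ∧ wb ∉ R ∧ wc ∉ R ∧ wa ≠ wb ∧ wa ≠ wc ∧ wb ≠ wc ∧
      p1 ∉ R ∪ {wa, wb, wc} ∧ p2 ∉ R ∪ {wa, wb, wc} ∧ p1 ≠ p2 ∧
      p1 ∈ G ∧ p2 ∈ G ∧ wa ∈ G ∧ wb ∈ G ∧ wc ∈ G ∧
      wa ∉ clF M (R ∪ {wb, wc}) ∧ wb ∉ clF M (R ∪ {wa, wc}) ∧ wc ∉ clF M (R ∪ {wa, wb}) ∧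
      p1 ∉ clF M (R ∪ {wb, wc}) ∧ p1 ∈ clF M (R ∪ {wa, wc}) ∧ p1 ∈ clF M (R ∪ {wa, wb}) ∧
      p2 ∉ clF M (R ∪ {wa, wc}) ∧ p2 ∈ clF M (R ∪ {wb, wc}) ∧ p2 ∈ clF M (R ∪ {wa, wb}) := by
  have hd' : (gr M \ G).card ≤ 5 := by omega
  have hGg : G ⊆ gr M := (mem_flatsQ.1 hG).1
  have hKB : coloops M G ⊆ B := coloops_subset_of_mem_thinMembers hG hd' hB
  have hBG : B ⊆ G := subset_G_of_mem_thinMembers hB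
  have hzG : z ∈ G := (Finset.mem_sdiff.1 hz).1
  have hzcl : z ∉ clF M B := (Finset.mem_sdiff.1 hz).2
  have hzB : z ∉ B := fun hzB => hzcl (subset_clF_of_subset_gr (hBG.trans hGg) hzB)
  have hzK : z ∉ coloops M G := fun hzK => hzB (hKB hzK)
  have hQG : insert z B ⊆ G := Finset.insert_subset hzG hBG
  have hKQ : coloops M G ⊆ insert z B := hKB.trans (Finset.subset_insert _ _)
  obtain ⟨e₀, he₀⟩ := Finset.card_eq_one.1 (show (coloops M G).card = 1 by
    rw [← kColoops_eq_card_coloops]; exact hk)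
  have he₀c : e₀ ∈ coloops M G := he₀ ▸ Finset.mem_singleton_self e₀
  have hrQ : rkN M (insert z B) = 6 := by
    rw [rkN_insert_of_notMem_clF (hGg hzG) hzcl, rkN_eq_five_of_mem_thinMembers hB]
  have hrQs : rkN M (insert z B \ coloops M G) = 5 := by
    have := rkN_eq_rkN_sdiff_add_one hG hk (S := insert z B) hQG (Finset.Subset.refl _) hKQ
    omega
  have hcardQ : 6 ≤ (insert z B \ coloops M G).card := by
    rw [Finset.insert_sdiff_of_notMem _ hzK,
      Finset.card_insert_of_notMem (fun hzB' => hzB (Finset.mem_sdiff.1 hzB').1)]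
    omega
  have hQsG : insert z B \ coloops M G ⊆ G := Finset.sdiff_subset.trans hQG
  have hfaces := thinFacesOf_eq_image_erase hG hd hk hs hl hB hbig hz h
  have h3 := card_coloops_eq_three_of_loss_ne_zero hG hd hk hs hl hB hbig hz h
  -- the distance-2 pair and its two faces
  obtain ⟨p, hp, rfl⟩ := mem_d2Targets.1 hT
  obtain ⟨⟨hp1, hp2⟩, hne, F, hF, F', hF', hFF', hp1F, hp2F'⟩ := mem_d2Pts.1 hp
  have hFt := hF
  have hF't := hF'
  rw [hfaces, Finset.mem_image] at hF hF'
  obtain ⟨w, hw, rfl⟩ := hF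
  obtain ⟨w', hw', rfl⟩ := hF'
  have hww' : w ≠ w' := by
    rintro rfl
    exact hFF' rfl
  -- the third coloop
  obtain ⟨w'', hw''⟩ := Finset.card_eq_one.1
    (show (((coloops M (insert z B \ coloops M G)).erase w).erase w').card = 1 by
      rw [Finset.card_erase_of_mem (Finset.mem_erase.2 ⟨hww'.symm, hw'⟩), Finset.card_erase_of_mem hw, h3])
  have hw''mem : w'' ∈ ((coloops M (insert z B \ coloops M G)).erase w).erase w' :=
    hw'' ▸ Finset.mem_singleton_self w''
  rw [Finset.mem_erase, Finset.mem_erase] at hw''mem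
  have hcol : coloops M (insert z B \ coloops M G) = {w, w', w''} :=
    coloops_eq_triple h3 hw hw' hw''mem.2.2 hww' hw''mem.2.1.symm hw''mem.1.symm
  have hCQ : {w, w', w''} ⊆ insert z B \ coloops M G := by
    rw [← hcol]
    exact fun a ha => (mem_coloops.1 ha).1
  have hQ' : insert z B \ coloops M G = ((insert z B \ coloops M G) \ {w, w', w''}) ∪ {w, w', w''} :=
    (Finset.sdiff_union_of_subset hCQ).symm
  have hrk := rkN_sdiff_add_card_of_subset_coloops (M := M) (hQsG.trans hGg) (T := {w, w', w''})
    (by rw [← hcol])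
  have hc3 : ({w, w', w''} : Finset α).card = 3 := by rw [← hcol]; exact h3
  rw [hrQs, hc3] at hrk
  have hcardR := Finset.card_sdiff_add_card_eq_card hCQ
  rw [hc3] at hcardR
  have hwR : w ∉ (insert z B \ coloops M G) \ {w, w', w''} := fun h' => (Finset.mem_sdiff.1 h').2 (by simp)
  have hw'R : w' ∉ (insert z B \ coloops M G) \ {w, w', w''} := fun h' => (Finset.mem_sdiff.1 h').2 (by simp)
  have hw''R : w'' ∉ (insert z B \ coloops M G) \ {w, w', w''} := fun h' => (Finset.mem_sdiff.1 h').2 (by simp)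
  have hcolw : ∀ v ∈ coloops M (insert z B \ coloops M G),
      v ∉ clF M ((insert z B \ coloops M G).erase v) := fun v hv => (mem_coloops.1 hv).2
  -- bridge: membership in `clF (Q.erase v)` gives membership in `clF (Q'.erase v)` for points `≠ e₀`
  have hbridge : ∀ v, ∀ x ∈ G, x ≠ e₀ → x ∈ clF M ((insert z B).erase v) →
      x ∈ clF M ((insert z B \ coloops M G).erase v) := by
    intro v x hxG hxe hx
    have h1 := mem_clF_erase_coloop_of_mem_clF hG he₀c ((Finset.erase_subset _ _).trans hQG) hxG hxe hx
    have heq : ((insert z B).erase v).erase e₀ = (insert z B \ coloops M G).erase v := by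
      rw [he₀, Finset.sdiff_singleton_eq_erase, Finset.erase_right_comm]
    rw [heq] at h1
    exact h1
  have hp1e : p.1 ≠ e₀ := fun h' => (Finset.mem_sdiff.1 hp1).2 (h' ▸ hKQ he₀c)
  have hp2e : p.2 ≠ e₀ := fun h' => (Finset.mem_sdiff.1 hp2).2 (h' ▸ hKQ he₀c)
  have hp1K : p.1 ∉ coloops M G := fun hk' => (Finset.mem_sdiff.1 hp1).2 (hKQ hk')
  have hp2K : p.2 ∉ coloops M G := fun hk' => (Finset.mem_sdiff.1 hp2).2 (hKQ hk')
  have hp1Q : p.1 ∉ insert z B := (Finset.mem_sdiff.1 hp1).2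
  have hp2Q : p.2 ∉ insert z B := (Finset.mem_sdiff.1 hp2).2
  have hface : ∀ v ∈ coloops M (insert z B \ coloops M G),
      (insert z B).erase v ∈ thinFacesOf M 5 G (insert z B) := by
    intro v hv
    rw [hfaces]
    exact Finset.mem_image_of_mem _ hv
  have herase_ne : ∀ v ∈ coloops M (insert z B \ coloops M G), ∀ u, v ≠ u →
      (insert z B).erase v ≠ (insert z B).erase u := by
    intro v hv u hvu heq
    have hvQ : v ∈ insert z B := (Finset.mem_sdiff.1 (mem_coloops.1 hv).1).1
    have hmem : v ∈ (insert z B).erase u := Finset.mem_erase.2 ⟨hvu, hvQ⟩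
    rw [← heq] at hmem
    exact (Finset.mem_erase.1 hmem).1 rfl
  -- covering
  have hcov1 : ∀ v ∈ coloops M (insert z B \ coloops M G), v ≠ w → p.1 ∈ clF M ((insert z B).erase v) :=
    fun v hv hvw => mem_clF_of_not_gtPts hG hd hk hs hl hB hbig hz h hno hp1 hFt hp1F (hface v hv)
      (herase_ne v hv w hvw)
  have hcov2 : ∀ v ∈ coloops M (insert z B \ coloops M G), v ≠ w' → p.2 ∈ clF M ((insert z B).erase v) :=
    fun v hv hvw => mem_clF_of_not_gtPts hG hd hk hs hl hB hbig hz h hno hp2 hF't hp2F' (hface v hv)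
      (herase_ne v hv w' hvw)
  have hsubQ : insert z B \ coloops M G ⊆ insert z B := Finset.sdiff_subset
  have hQ'b : insert z B \ coloops M G = ((insert z B \ coloops M G) \ {w, w', w''}) ∪ {w', w, w''} :=
    hQ'.trans triple_perm_aux
  have hQ'c : insert z B \ coloops M G = ((insert z B \ coloops M G) \ {w, w', w''}) ∪ {w'', w, w'} :=
    hQ'.trans triple_perm_aux'
  refine ⟨(insert z B \ coloops M G) \ {w, w', w''}, w, w', w'', p.1, p.2, hcol, by rw [hcol], hQ', ?_, ?_, ?_, ?_, ?_,
    hwR, hw'R, hw''R,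
    hww', hw''mem.2.1.symm, hw''mem.1.symm, ?_, ?_, hne, (Finset.mem_sdiff.1 hp1).1, (Finset.mem_sdiff.1 hp2).1,
    hQsG (hCQ (by simp)), hQsG (hCQ (by simp)), hQsG (hCQ (by simp)), ?_, ?_, ?_, ?_, ?_, ?_, ?_, ?_, ?_⟩
  · rw [Finset.insert_sdiff_of_notMem _ hp1K, Finset.insert_sdiff_of_notMem _ hp2K, ← hQ']
  · exact Finset.insert_subset (Finset.mem_sdiff.1 hp1).1
      (Finset.insert_subset (Finset.mem_sdiff.1 hp2).1 hQG)
  · omega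
  · omega
  · exact Finset.sdiff_subset.trans hQsG
  · rw [← hQ']
    exact fun h' => hp1Q (hsubQ h')
  · rw [← hQ']
    exact fun h' => hp2Q (hsubQ h')
  · exact fun h' => hcolw w hw (clF_mono (subset_erase_coloop_aux hQ' hwR hww' hw''mem.2.1.symm) h')
  · exact fun h' => hcolw w' hw' (clF_mono (subset_erase_coloop_aux hQ'b hw'R hww'.symm hw''mem.1.symm) h')
  · exact fun h' => hcolw w'' hw''mem.2.2
      (clF_mono (subset_erase_coloop_aux hQ'c hw''R hw''mem.2.1 hw''mem.1) h')
  · exact fun h' => hp1F (clF_mono ((subset_erase_coloop_aux hQ' hwR hww' hw''mem.2.1.symm).trans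
      (Finset.erase_subset_erase _ hsubQ)) h')
  · have h1 := hbridge w' p.1 (Finset.mem_sdiff.1 hp1).1 hp1e (hcov1 w' hw' hww'.symm)
    exact clF_mono (fun a ha => erase_coloop_subset_aux hQ'b a ha) h1
  · have h1 := hbridge w'' p.1 (Finset.mem_sdiff.1 hp1).1 hp1e (hcov1 w'' hw''mem.2.2 hw''mem.2.1)
    exact clF_mono (fun a ha => erase_coloop_subset_aux hQ'c a ha) h1
  · exact fun h' => hp2F' (clF_mono ((subset_erase_coloop_aux hQ'b hw'R hww'.symm hw''mem.1.symm).trans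
      (Finset.erase_subset_erase _ hsubQ)) h')
  · have h1 := hbridge w p.2 (Finset.mem_sdiff.1 hp2).1 hp2e (hcov2 w hw hww')
    exact clF_mono (fun a ha => erase_coloop_subset_aux hQ' a ha) h1
  · have h1 := hbridge w'' p.2 (Finset.mem_sdiff.1 hp2).1 hp2e (hcov2 w'' hw''mem.2.2 hw''mem.1)
    exact clF_mono (fun a ha => erase_coloop_subset_aux hQ'c a ha) h1


/-- **A distance-2 target has a coloop off `K`**: the third point `w_c` of the shape, off the hyperplane
`clF (R ∪ {wₐ, w_b})` that contains the other points of `T ∖ K`. -/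
theorem coloops_nonempty_of_mem_d2Targets (hG : G ∈ flatsQ M (5 + 1)) (hd : (gr M \ G).card = 2)
    (hk : kColoops M G = 1) (hs : ∀ e ∈ gr M, ∀ f ∈ gr M, e ≠ f → rkN M {e, f} = 2)
    (hl : ∀ e ∈ gr M, M.Indep {e}) {B : Finset α} (hB : B ∈ thinMembers M 5 G)
    (hbig : 5 ≤ (B \ coloops M G).card) {z : α} (hz : z ∈ G \ clF M B) (h : loss M 5 G B z ≠ 0)
    (hno : ¬ (gtPts M 5 G (insert z B)).Nonempty) {T : Finset α} (hT : T ∈ d2Targets M 5 G (insert z B)) :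
    (coloops M (T \ coloops M G)).Nonempty := by
  obtain ⟨R, wa, wb, wc, p1, p2, hTK, -, -, -, hRG, -, -, -, -, -, -, -, -, -, -, -, hwaG, hwbG, -, -, -, hwcH, -,
    -, hp1c, -, -, hp2c⟩ := d2Target_shape hG hd hk hs hl hB hbig hz h hno hT
  have hGg : G ⊆ gr M := (mem_flatsQ.1 hG).1
  have hXg : R ∪ {wa, wb} ⊆ gr M := Finset.union_subset (hRG.trans hGg) (by
    intro a ha
    rw [Finset.mem_insert, Finset.mem_singleton] at ha
    rcases ha with rfl | rfl
    exacts [hGg hwaG, hGg hwbG])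
  refine ⟨wc, mem_coloops.2 ⟨?_, ?_⟩⟩
  · rw [hTK]
    simp
  · intro hmem
    apply hwcH
    refine clF_subset_clF_of_subset_clF ?_ hmem
    intro x hx
    rw [Finset.mem_erase, hTK] at hx
    simp only [Finset.mem_insert, Finset.mem_union, Finset.mem_singleton] at hx
    rcases hx.2 with rfl | rfl | hR | rfl | rfl | rfl
    · exact hp1c
    · exact hp2c
    · exact subset_clF_of_subset_gr hXg (Finset.mem_union_left _ hR)
    · exact subset_clF_of_subset_gr hXg (by simp)
    · exact subset_clF_of_subset_gr hXg (by simp)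
    · exact absurd rfl hx.1

end PercRepro.Shadow
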